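import Literature.Probability.Divergences.RenyiDivergence
import Mathlib.MeasureTheory.Integral.MeanInequalities
import HarnessLib

/-!
# Probability preservation for the Rényi divergence — measure level (countable and general carriers)

Topic `Probability/Divergences`; namespace `Literature.Probability.Divergences`. PROVED, no definition, no named
fact. Companion of `RenyiFinite.lean` (the same inequality for finite weight vectors:
`sum_rpow_le_mul_renyiSum`, `measure_rpow_div_renyiDivFin_le`) for the tree's GENERAL object
`hellingerIntegral a μ ν = ∫ (dμ/dν)^a dν` (`RenyiDivergence.lean`, [vEH14] Def. 2 conventions), hence for laws
on countable carriers (`PMF.toMeasure`) such as lattice-coset Gaussians.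

PRINTED STATEMENT («probability preservation», [LSS14, Lem. 4.1] = [BLL+15, Lem. 2.9] as quoted in
[FGdGJK26] App. A Lemma 14, HAL hal-05635650v1 p0028 L6–L11, and [Pre17] §2.2 Lemma 1 / eq. (2), held volume
`book:editornd-advances-cryptology-asiacrypt-2017` chunk p0463 L18): «Let `E ⊆ Supp(Q)` be an arbitrary event. If
`a ∈ (1, ∞)`, then `Q(E) ≥ P(E)^{a/(a−1)} / R_a(P‖Q)`», with the crypto-convention
`R_a(P‖Q) = (Σ_{x∈Supp(P)} P(x)^a/Q(x)^{a−1})^{1/(a−1)}` = `(hellingerIntegral a P Q)^{1/(a−1)}` for `P ≪ Q`.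
PROOF (the one-line Hölder argument of [LSS14]): `P(E) = ∫_E (dP/dQ) dQ ≤ (∫_E (dP/dQ)^a dQ)^{1/a} · Q(E)^{(a−1)/a}`.

What is here: `measure_le_rpow_setLIntegral_mul_rpow` (the Hölder step on a measurable set),
`measure_rpow_le_mul_hellingerIntegral` (`μ(E)^a ≤ ν(E)^{a−1} · hellingerIntegral a μ ν`),
`measure_rpow_le_mul_hellingerIntegral_rpow` (the printed shape `μ(E)^{a/(a−1)} ≤ ν(E) · R_a(μ‖ν)` with
`R_a = hellingerIntegral^{1/(a−1)}` written inline). Hypotheses: `μ ≪ ν` (the printed `Supp(P) ⊆ Supp(Q)`),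
`[μ.HaveLebesgueDecomposition ν]` (automatic for σ-finite measures, in particular for `PMF.toMeasure`), `1 < a`,
`E` measurable. Values in `ℝ≥0∞` with real exponents (`ENNReal.rpow`).
-/

noncomputable section

open MeasureTheory Set
open scoped ENNReal

namespace Literature.Probability.Divergences

variable {α : Type*} [MeasurableSpace α] {μ ν : Measure α}

/-- **The Hölder step** behind probability preservation, on a measurable set `E`, for `μ ≪ ν` and `a > 1`:
`μ(E) ≤ (∫_E (dμ/dν)^a dν)^{1/a} · ν(E)^{(a−1)/a}`.
[cite: FouqueEtAl2026CloserLookFalcon, App. A Lemma 14 (= [LSS14, Lem. 4.1]), proof step; Prest2017RenyiSharperBounds, §2.2 Lemma 1 / eq. (2)] -/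
theorem measure_le_rpow_setLIntegral_mul_rpow [μ.HaveLebesgueDecomposition ν] (hμν : μ ≪ ν) {a : ℝ}
    (ha : 1 < a) {E : Set α} (hE : MeasurableSet E) :
    μ E ≤ (∫⁻ x in E, (μ.rnDeriv ν x) ^ a ∂ν) ^ (1 / a) * (ν E) ^ ((a - 1) / a) := by
  have ha0 : 0 < a := by linarith
  have hpq : a.HolderConjugate (Real.conjExponent a) := Real.HolderConjugate.conjExponent ha
  have hf : AEMeasurable (μ.rnDeriv ν) (ν.restrict E) :=
    (Measure.measurable_rnDeriv μ ν).aemeasurable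
  have hg : AEMeasurable (fun _ : α => (1 : ℝ≥0∞)) (ν.restrict E) := aemeasurable_const
  have hH := ENNReal.lintegral_mul_le_Lp_mul_Lq (ν.restrict E) hpq hf hg
  -- `∫_E (dμ/dν)·1 dν = μ(E)`
  have hprod : ((μ.rnDeriv ν) * fun _ : α => (1 : ℝ≥0∞)) = μ.rnDeriv ν := by
    funext x; simp
  rw [hprod, Measure.setLIntegral_rnDeriv' hμν hE] at hH
  -- `(∫_E 1^q dν)^{1/q} = ν(E)^{(a−1)/a}`
  have hq : 1 / Real.conjExponent a = (a - 1) / a := by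
    rw [Real.conjExponent]
    have : a - 1 ≠ 0 := by linarith
    field_simp
  have hrhs : (∫⁻ x in E, (fun _ : α => (1 : ℝ≥0∞)) x ^ Real.conjExponent a ∂ν) ^ (1 / Real.conjExponent a)
      = (ν E) ^ ((a - 1) / a) := by
    simp only [ENNReal.one_rpow, setLIntegral_const, one_mul]
    rw [hq]
  rw [hrhs] at hH
  exact hH

/-- **Probability preservation, power form**: `μ(E)^a ≤ ν(E)^{a−1} · hellingerIntegral a μ ν` for `μ ≪ ν`, `a > 1`,
`E` measurable (the measure-level twin of `RenyiFinite.sum_rpow_le_mul_renyiSum`).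
[cite: FouqueEtAl2026CloserLookFalcon, App. A Lemma 14 (= [LSS14, Lem. 4.1]); Prest2017RenyiSharperBounds, §2.2 eq. (2)] -/
theorem measure_rpow_le_mul_hellingerIntegral [μ.HaveLebesgueDecomposition ν] (hμν : μ ≪ ν) {a : ℝ}
    (ha : 1 < a) {E : Set α} (hE : MeasurableSet E) :
    μ E ^ a ≤ ν E ^ (a - 1) * hellingerIntegral a μ ν := by
  have ha0 : 0 < a := by linarith
  have h1 := measure_le_rpow_setLIntegral_mul_rpow hμν ha hE
  -- raise to the power `a`
  have h2 : μ E ^ a ≤ ((∫⁻ x in E, (μ.rnDeriv ν x) ^ a ∂ν) ^ (1 / a) * (ν E) ^ ((a - 1) / a)) ^ a :=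
    ENNReal.rpow_le_rpow h1 ha0.le
  have h3 : ((∫⁻ x in E, (μ.rnDeriv ν x) ^ a ∂ν) ^ (1 / a) * (ν E) ^ ((a - 1) / a)) ^ a
      = (∫⁻ x in E, (μ.rnDeriv ν x) ^ a ∂ν) * (ν E) ^ (a - 1) := by
    rw [ENNReal.mul_rpow_of_nonneg _ _ ha0.le, ← ENNReal.rpow_mul, ← ENNReal.rpow_mul,
      one_div_mul_cancel ha0.ne', ENNReal.rpow_one, div_mul_cancel₀ _ ha0.ne']
  rw [h3] at h2
  -- `∫_E (dμ/dν)^a dν ≤ ∫ (dμ/dν)^a dν = hellingerIntegral a μ ν`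
  have h4 : ∫⁻ x in E, (μ.rnDeriv ν x) ^ a ∂ν ≤ hellingerIntegral a μ ν := by
    rw [hellingerIntegral_of_ac hμν]
    exact setLIntegral_le_lintegral E _
  calc μ E ^ a ≤ (∫⁻ x in E, (μ.rnDeriv ν x) ^ a ∂ν) * (ν E) ^ (a - 1) := h2
    _ ≤ hellingerIntegral a μ ν * (ν E) ^ (a - 1) := mul_le_mul' h4 le_rfl
    _ = ν E ^ (a - 1) * hellingerIntegral a μ ν := mul_comm _ _

/-- **Probability preservation, printed shape**: `μ(E)^{a/(a−1)} ≤ ν(E) · R_a(μ‖ν)` with the crypto-convention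
`R_a(μ‖ν) = (hellingerIntegral a μ ν)^{1/(a−1)}` (i.e. «`Q(E) ≥ P(E)^{a/(a−1)}/R_a(P‖Q)`»), for `μ ≪ ν`, `a > 1`,
`E` measurable. [cite: FouqueEtAl2026CloserLookFalcon, App. A Lemma 14 (= [LSS14, Lem. 4.1]); Prest2017RenyiSharperBounds, §1 eq. (2) / §2.2 Lemma 1] -/
theorem measure_rpow_le_mul_hellingerIntegral_rpow [μ.HaveLebesgueDecomposition ν] (hμν : μ ≪ ν) {a : ℝ}
    (ha : 1 < a) {E : Set α} (hE : MeasurableSet E) :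
    μ E ^ (a / (a - 1)) ≤ ν E * hellingerIntegral a μ ν ^ (1 / (a - 1)) := by
  have ha0 : 0 < a := by linarith
  have ha1 : 0 < a - 1 := by linarith
  have hexp : 0 ≤ a / (a - 1) := by positivity
  have h1 := measure_le_rpow_setLIntegral_mul_rpow hμν ha hE
  have h2 : μ E ^ (a / (a - 1))
      ≤ ((∫⁻ x in E, (μ.rnDeriv ν x) ^ a ∂ν) ^ (1 / a) * (ν E) ^ ((a - 1) / a)) ^ (a / (a - 1)) :=
    ENNReal.rpow_le_rpow h1 hexp
  have h3 : ((∫⁻ x in E, (μ.rnDeriv ν x) ^ a ∂ν) ^ (1 / a) * (ν E) ^ ((a - 1) / a)) ^ (a / (a - 1))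
      = (∫⁻ x in E, (μ.rnDeriv ν x) ^ a ∂ν) ^ (1 / (a - 1)) * ν E := by
    rw [ENNReal.mul_rpow_of_nonneg _ _ hexp, ← ENNReal.rpow_mul, ← ENNReal.rpow_mul]
    have e1 : 1 / a * (a / (a - 1)) = 1 / (a - 1) := by field_simp
    have e2 : (a - 1) / a * (a / (a - 1)) = 1 := by field_simp
    rw [e1, e2, ENNReal.rpow_one]
  rw [h3] at h2
  have h4 : ∫⁻ x in E, (μ.rnDeriv ν x) ^ a ∂ν ≤ hellingerIntegral a μ ν := by
    rw [hellingerIntegral_of_ac hμν]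
    exact setLIntegral_le_lintegral E _
  have h5 : (∫⁻ x in E, (μ.rnDeriv ν x) ^ a ∂ν) ^ (1 / (a - 1)) ≤ hellingerIntegral a μ ν ^ (1 / (a - 1)) :=
    ENNReal.rpow_le_rpow h4 (by positivity)
  calc μ E ^ (a / (a - 1)) ≤ (∫⁻ x in E, (μ.rnDeriv ν x) ^ a ∂ν) ^ (1 / (a - 1)) * ν E := h2
    _ ≤ hellingerIntegral a μ ν ^ (1 / (a - 1)) * ν E := mul_le_mul' h5 le_rfl
    _ = ν E * hellingerIntegral a μ ν ^ (1 / (a - 1)) := mul_comm _ _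

end Literature.Probability.Divergences

end
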